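import Literature.NumberTheory.DiophantineGeometry.RationalPointsDecomposition
import Literature.RingTheory.MvPolynomial.KaltofenNoetherFormsThm7Proofs
import Literature.ModelTheory.PseudofiniteFields.DefinablePredicates
import Literature.ModelTheory.PseudofiniteFields.UniformBound
import Literature.ModelTheory.PseudofiniteFields.FiniteFieldTheory
import Mathlib.ModelTheory.Algebra.Ring.FreeCommRing
import Mathlib.RingTheory.FreeCommRing
import Mathlib.Algebra.MvPolynomial.Monad
import Mathlib.Tactic.DeriveFintype
import HarnessLib

/-!
# Lang–Weil shape transfer: decompositions of zero sets over large finite fields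

Topic `Literature/ModelTheory/PseudofiniteFields`.  Main result (`exists_decomposition_finiteField`):
for all `e, n, r` there are `B` and `q₀` such that for every finite field `F` with `#F ≥ q₀` and
every system `f₁, …, f_r ∈ F[X₁, …, Xₙ]` of total degrees `≤ e`, the set of `F`-rational zeros
is empty or admits a rational-trace decomposition (`Decomposition F n V B` of
`RationalPointsDecomposition.lean`) of complexity `≤ B`.  This is the uniformity half of the
Lang–Weil estimate for arbitrary affine algebraic sets (Chatzidakis–van den Dries–Macintyre
1992, Prop. 3.3), obtained here by "pure logic" from Theorem A over perfect fields:

1. **The shape is first order** (`exists_formula_semB`).  A decomposition of complexity `B` is a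
   finite amount of data: a shape `(d, μ, L)` from the finite set `ShapeIdx n B` and the
   coefficients (`ShapeVar`, a finite type) of the polynomials `T, U, m, δ, w, T', N` of
   degree `≤ B` ("box polynomials" `boxPoly`, exponents in `Box m B = Fin m → Fin (B+1)`).  The
   clauses (a)–(d) are polynomial identities in these coefficients and in finitely many
   quantified point variables (generic terms `boxApp`, `parT`, `liftT`; atoms are integer
   polynomials turned into ring terms by `termOfPoly`); monicity in `X₀` is a condition on the
   coefficients (`MonicBox`, `monicIn0_boxPoly_iff`); and ABSOLUTE IRREDUCIBILITY of the
   `m_i` is first order by Kaltofen's effective Noether irreducibility forms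
   (`kaltofen1995_thm7_holds`, packaged as `KForms`/`CertBox`: for `d ≥ 1` and formal degree
   `D ≥ 2` some form does not vanish; the remaining case is `m_i` linear in `X₀`, and in one
   variable an absolutely irreducible monic polynomial is linear,
   `eq_one_of_isAbsIrreducible_of_monicIn0`).  The resulting semantic statement `SemB` is
   equivalent to the existence of a decomposition in both directions over EVERY field
   (`semB_of_decomposition`, `decomposition_of_condSem`).
2. **Compactness** (`exists_uniform_bound_of_pseudoFinite`): by Theorem A
   (`exists_decomposition`, pseudo-finite fields being perfect,
   `perfectField_of_model_finiteFieldTheory`) every tuple of coefficients in every pseudo-finite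
   field satisfies some `θ_B`, hence one `B` works for all.
3. **Transfer** (`eventually_realize_forall_of_pseudoFinite`) to all finite fields with `q ≥ q₀`.

No new facts; everything is proved.  The counting that turns a decomposition into the estimate
`#V = μ q^d + O(q^{d - 1/2})` is in `DefinableSetsFiniteFieldsProp33Proofs.lean`.

## References

* Z. Chatzidakis, L. van den Dries, A. Macintyre, Definable sets over finite fields, J. reine
  angew. Math. 427 (1992) 107–135, Prop. 3.3 and §2. [ChatzidakisVanDenDriesMacintyre1992]
* E. Kaltofen, Effective Noether irreducibility forms and applications, J. Comput. System Sci.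
  50 (1995) 274–295, Thm. 7. [Kaltofen1995]
* S. Lang, A. Weil, Number of points of varieties in finite fields, Amer. J. Math. 76 (1954)
  819–827. [LangWeil1954]
-/

noncomputable section

open MvPolynomial
open scoped Polynomial

namespace Literature.ModelTheory.PseudofiniteFields

open Literature.NumberTheory.DiophantineGeometry Literature.RingTheory.MvPolynomial
open FirstOrder FirstOrder.Language FirstOrder.Ring
/-! ### Box polynomials: polynomials of bounded multidegree from a box of coefficients -/

section Box

/-- Exponent vectors of multidegree `≤ N` in `m` variables (a finite type). [folklore] -/
abbrev Box (m N : ℕ) : Type := Fin m → Fin (N + 1)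

variable {m N : ℕ}

/-- The exponent of a box vector. [folklore] -/
def Box.toExp (β : Box m N) : Fin m →₀ ℕ := Finsupp.equivFunOnFinite.symm fun l => (β l : ℕ)

/-- Components of the exponent of a box vector. [folklore] -/
@[simp] theorem Box.toExp_apply (β : Box m N) (l : Fin m) : β.toExp l = β l := by
  simp [Box.toExp]

/-- The exponent of a box vector has multidegree `≤ N`. [folklore] -/
theorem Box.toExp_le (β : Box m N) (l : Fin m) : β.toExp l ≤ N := by
  rw [Box.toExp_apply]; exact Nat.le_of_lt_succ (β l).isLt

/-- The box vector of an exponent of multidegree `≤ N`. [folklore] -/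
def Box.ofExp (e : Fin m →₀ ℕ) (h : ∀ l, e l ≤ N) : Box m N := fun l => ⟨e l, Nat.lt_succ_of_le (h l)⟩

/-- `ofExp` then `toExp`. [folklore] -/
@[simp] theorem Box.toExp_ofExp (e : Fin m →₀ ℕ) (h : ∀ l, e l ≤ N) : (Box.ofExp e h).toExp = e :=
  Finsupp.ext fun l => by simp [Box.ofExp]

/-- `toExp` then `ofExp`. [folklore] -/
@[simp] theorem Box.ofExp_toExp (β : Box m N) (h : ∀ l, β.toExp l ≤ N) : Box.ofExp β.toExp h = β :=
  funext fun l => Fin.ext (by simp [Box.ofExp])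

/-- `toExp` is injective. [folklore] -/
theorem Box.toExp_injective : Function.Injective (Box.toExp : Box m N → Fin m →₀ ℕ) :=
  fun β β' h => funext fun l => Fin.ext (by
    have h1 := DFunLike.congr_fun h l
    simpa only [Box.toExp_apply] using h1)

variable {K : Type*} [CommSemiring K]

/-- The polynomial with the given box of coefficients. [folklore] -/
def boxPoly (c : Box m N → K) : MvPolynomial (Fin m) K := ∑ β, monomial β.toExp (c β)

/-- Coefficients of a box polynomial. [folklore] -/
theorem coeff_boxPoly (c : Box m N → K) (e : Fin m →₀ ℕ) :
    (boxPoly c).coeff e = if h : ∀ l, e l ≤ N then c (Box.ofExp e h) else 0 := by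
  classical
  simp only [boxPoly, coeff_sum, coeff_monomial]
  split_ifs with h
  · rw [Finset.sum_eq_single (Box.ofExp e h)]
    · simp
    · intro β _ hβ
      rw [if_neg]
      intro heq
      apply hβ
      subst heq
      exact (Box.ofExp_toExp β _).symm
    · simp
  · refine Finset.sum_eq_zero fun β _ => ?_
    rw [if_neg]
    intro heq
    apply h
    intro l
    rw [← heq]
    exact β.toExp_le l

/-- The coefficient of a box polynomial at a box exponent. [folklore] -/
@[simp] theorem coeff_boxPoly_toExp (c : Box m N → K) (β : Box m N) :
    (boxPoly c).coeff β.toExp = c β := by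
  rw [coeff_boxPoly, dif_pos β.toExp_le, Box.ofExp_toExp]

/-- Evaluation of a box polynomial. [folklore] -/
theorem eval_boxPoly (c : Box m N → K) (x : Fin m → K) :
    eval x (boxPoly c) = ∑ β, c β * ∏ l, x l ^ (β l : ℕ) := by
  simp only [boxPoly, map_sum, eval_monomial]
  refine Finset.sum_congr rfl fun β _ => ?_
  congr 1
  rw [Finsupp.prod_fintype]
  · simp only [Box.toExp_apply]
  · intro l
    exact pow_zero _

/-- Exponents in the support of a polynomial of total degree `≤ N` have multidegree `≤ N`.
[folklore] -/
theorem apply_le_of_totalDegree_le {f : MvPolynomial (Fin m) K} (hf : f.totalDegree ≤ N)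
    {e : Fin m →₀ ℕ} (he : e ∈ f.support) (l : Fin m) : e l ≤ N := by
  classical
  have h1 : (e.sum fun _ k => k) ≤ f.totalDegree := le_totalDegree he
  have h2 : e l ≤ e.sum fun _ k => k := by
    by_cases hl : l ∈ e.support
    · exact Finset.single_le_sum (f := fun i => e i) (fun _ _ => Nat.zero_le _) hl
    · rw [Finsupp.notMem_support_iff.mp hl]
      exact Nat.zero_le _
  omega

/-- A polynomial of total degree `≤ N` is the box polynomial of its coefficients. [folklore] -/
theorem boxPoly_coeff_eq {f : MvPolynomial (Fin m) K} (hf : f.totalDegree ≤ N) :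
    boxPoly (fun β : Box m N => f.coeff β.toExp) = f := by
  ext e
  rw [coeff_boxPoly]
  split_ifs with h
  · simp only [Box.toExp_ofExp]
  · rw [eq_comm, ← notMem_support_iff]
    exact fun he => h (apply_le_of_totalDegree_le hf he)

/-- Total degree of a box polynomial. [folklore] -/
theorem totalDegree_boxPoly_le_mul (c : Box m N → K) : (boxPoly c).totalDegree ≤ m * N := by
  refine Finset.sup_le fun e he => ?_
  have hc := mem_support_iff.mp he
  rw [coeff_boxPoly] at hc
  split_ifs at hc with h
  · calc (e.sum fun _ k => k) = ∑ l, e l := by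
          rw [Finsupp.sum_fintype]
          intro _; rfl
      _ ≤ ∑ _l : Fin m, N := Finset.sum_le_sum fun l _ => h l
      _ = m * N := by simp
  · exact absurd rfl hc

/-- Exponents in the support of a box polynomial come from the box. [folklore] -/
theorem exists_toExp_eq_of_mem_support (c : Box m N → K) {e : Fin m →₀ ℕ}
    (he : e ∈ (boxPoly c).support) : ∃ β : Box m N, β.toExp = e ∧ c β ≠ 0 := by
  have hc := mem_support_iff.mp he
  rw [coeff_boxPoly] at hc
  split_ifs at hc with h
  · exact ⟨Box.ofExp e h, Box.toExp_ofExp e h, hc⟩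
  · exact absurd rfl hc

/-- A box polynomial vanishes iff all its coefficients do. [folklore] -/
theorem boxPoly_eq_zero_iff (c : Box m N → K) : boxPoly c = 0 ↔ ∀ β, c β = 0 := by
  constructor
  · intro h β
    have h1 := congrArg (coeff β.toExp) h
    rwa [coeff_boxPoly_toExp, coeff_zero] at h1
  · intro h
    simp [boxPoly, h]

/-- The degree of an exponent box vector. [folklore] -/
def Box.deg (β : Box m N) : ℕ := ∑ l, (β l : ℕ)

/-- The total degree of a box polynomial whose coefficients vanish above degree `D` is `≤ D`.
[folklore] -/
theorem totalDegree_boxPoly_le_of_forall (c : Box m N → K) {D : ℕ}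
    (h : ∀ β : Box m N, D < β.deg → c β = 0) : (boxPoly c).totalDegree ≤ D := by
  refine Finset.sup_le fun e he => ?_
  obtain ⟨β, rfl, hβ⟩ := exists_toExp_eq_of_mem_support c he
  by_contra hlt
  have hdeg : (β.toExp.sum fun _ k => k) = β.deg := by
    unfold Box.deg
    rw [Finsupp.sum_fintype]
    · simp only [Box.toExp_apply]
    · intro _; rfl
  refine hβ (h β ?_)
  rw [← hdeg]
  exact not_le.mp hlt

end Box

/-! ### `MonicIn0` through coefficients -/

section Monic

variable {K : Type*} [Field K] {d N : ℕ}

/-- Monicity of degree `k` in `X₀` in terms of the coefficients. [folklore] -/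
theorem monicIn0_iff_coeff (m : MvPolynomial (Fin (d + 1)) K) (k : ℕ) :
    MonicIn0 m k ↔ (∀ i, k < i → ∀ e : Fin d →₀ ℕ, m.coeff (e.cons i) = 0) ∧
      ∀ e : Fin d →₀ ℕ, m.coeff (e.cons k) = if e = 0 then 1 else 0 := by
  set q := finSuccEquiv K d m with hq
  have hc : ∀ (i : ℕ) (e : Fin d →₀ ℕ), m.coeff (e.cons i) = coeff e (q.coeff i) := fun i e =>
    (finSuccEquiv_coeff_coeff e m i).symm
  have h1 : (∀ i, k < i → ∀ e : Fin d →₀ ℕ, m.coeff (e.cons i) = 0) ↔ ∀ i, k < i → q.coeff i = 0 := by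
    refine forall_congr' fun i => forall_congr' fun _ => ?_
    rw [MvPolynomial.ext_iff]
    simp only [hc, coeff_zero]
  have h2 : (∀ e : Fin d →₀ ℕ, m.coeff (e.cons k) = if e = 0 then 1 else 0) ↔ q.coeff k = 1 := by
    rw [MvPolynomial.ext_iff]
    refine forall_congr' fun e => ?_
    rw [hc, coeff_one]
    rcases eq_or_ne e 0 with rfl | he
    · simp
    · simp [he, Ne.symm he]
  rw [h1, h2]
  unfold MonicIn0
  rw [← hq]
  constructor
  · rintro ⟨hmon, hdeg⟩
    refine ⟨fun i hi => Polynomial.coeff_eq_zero_of_natDegree_lt (hdeg ▸ hi), ?_⟩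
    rw [← hdeg]
    exact hmon
  · rintro ⟨hzero, hk⟩
    have hle : q.natDegree ≤ k := Polynomial.natDegree_le_iff_coeff_eq_zero.mpr hzero
    have hge : k ≤ q.natDegree := Polynomial.le_natDegree_of_ne_zero (by rw [hk]; exact one_ne_zero)
    have hdeg : q.natDegree = k := le_antisymm hle hge
    refine ⟨?_, hdeg⟩
    rw [Polynomial.Monic, Polynomial.leadingCoeff, hdeg, hk]

/-- The coefficient conditions "monic of degree `k` in `X₀`" on a box of coefficients in `d + 1`
variables: nothing above `X₀^k`, and the coefficient of `X₀^k` is the constant `1`. [folklore] -/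
def MonicBox (c : Box (d + 1) N → K) (k : ℕ) : Prop :=
  (∀ β : Box (d + 1) N, k < (β 0 : ℕ) → c β = 0) ∧
    ∀ β : Box (d + 1) N, (β 0 : ℕ) = k → c β = if ∀ l : Fin d, (β l.succ : ℕ) = 0 then 1 else 0

/-- For a box polynomial, `MonicIn0` is the coefficient condition `MonicBox`. [folklore] -/
theorem monicIn0_boxPoly_iff (c : Box (d + 1) N → K) {k : ℕ} (hk : k ≤ N) :
    MonicIn0 (boxPoly c) k ↔ MonicBox c k := by
  rw [monicIn0_iff_coeff]
  constructor
  · rintro ⟨hA, hB⟩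
    refine ⟨fun β hβ => ?_, fun β hβ => ?_⟩
    · rw [← coeff_boxPoly_toExp c β, ← Finsupp.cons_tail β.toExp]
      exact hA _ (by simpa using hβ) _
    · rw [← coeff_boxPoly_toExp c β, ← Finsupp.cons_tail β.toExp, Box.toExp_apply, hβ, hB]
      congr 1
      simp only [Finsupp.ext_iff, Finsupp.tail_apply, Box.toExp_apply, Finsupp.coe_zero,
        Pi.zero_apply]
  · rintro ⟨hA, hB⟩
    refine ⟨fun i hi e => ?_, fun e => ?_⟩
    · rw [coeff_boxPoly]
      split_ifs with h
      · refine hA _ ?_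
        simp only [Box.ofExp, Finsupp.cons_zero]
        exact hi
      · rfl
    · rw [coeff_boxPoly]
      split_ifs with h he he
      · rw [hB _ (by simp [Box.ofExp, Finsupp.cons_zero])]
        rw [if_pos]
        intro l
        simp [Box.ofExp, Finsupp.cons_succ, he]
      · rw [hB _ (by simp [Box.ofExp, Finsupp.cons_zero]), if_neg]
        intro hall
        apply he
        ext l
        have := hall l
        simpa [Box.ofExp, Finsupp.cons_succ] using this
      · exfalso
        apply h
        intro l
        refine Fin.cases ?_ (fun j => ?_) l
        · rw [Finsupp.cons_zero]; exact hk
        · rw [Finsupp.cons_succ, he]; exact Nat.zero_le _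
      · rfl

end Monic

/-! ### Absolute irreducibility: the linear case and the univariate case -/

section AbsIrr

variable {K : Type*} [Field K] {d : ℕ}

/-- `MonicIn0` is preserved under extension of scalars. [folklore] -/
theorem monicIn0_map {L : Type*} [Field L] (ι : K →+* L) {m : MvPolynomial (Fin (d + 1)) K}
    {k : ℕ} (h : MonicIn0 m k) : MonicIn0 (MvPolynomial.map ι m) k := by
  unfold MonicIn0 at h ⊢
  have hnat : finSuccEquiv L d (MvPolynomial.map ι m) =
      Polynomial.map (MvPolynomial.map ι) (finSuccEquiv K d m) := by
    ext i e
    rw [finSuccEquiv_coeff_coeff, coeff_map, Polynomial.coeff_map, coeff_map,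
      finSuccEquiv_coeff_coeff]
  rw [hnat]
  have hinj : Function.Injective
      (MvPolynomial.map ι : MvPolynomial (Fin d) K →+* MvPolynomial (Fin d) L) :=
    map_injective ι ι.injective
  exact ⟨h.1.map _, by rw [Polynomial.natDegree_map_eq_of_injective hinj, h.2]⟩

/-- A polynomial monic of degree `1` in `X₀` is irreducible. [folklore] -/
theorem irreducible_of_monicIn0_one {m : MvPolynomial (Fin (d + 1)) K} (h : MonicIn0 m 1) :
    Irreducible m := by
  have hq : Irreducible (finSuccEquiv K d m) := by
    obtain ⟨hmon, hdeg⟩ := h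
    rw [hmon.irreducible_iff_natDegree]
    refine ⟨fun h1 => ?_, fun f g hf hg hfg => ?_⟩
    · rw [h1, Polynomial.natDegree_one] at hdeg
      exact zero_ne_one hdeg
    · have h2 := congrArg Polynomial.natDegree hfg
      rw [hf.natDegree_mul hg, hdeg] at h2
      omega
  exact (MulEquiv.irreducible_iff (finSuccEquiv K d).toMulEquiv).mp (by exact hq)

/-- A polynomial monic of degree `1` in `X₀` is absolutely irreducible. [folklore] -/
theorem isAbsIrreducible_of_monicIn0_one {m : MvPolynomial (Fin (d + 1)) K} (h : MonicIn0 m 1) :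
    IsAbsIrreducible m :=
  irreducible_of_monicIn0_one (monicIn0_map (algebraMap K (AlgebraicClosure K)) h)

/-- An absolutely irreducible polynomial in ONE variable, monic of degree `k`, has `k = 1`.
[folklore] -/
theorem eq_one_of_isAbsIrreducible_of_monicIn0 {m : MvPolynomial (Fin (0 + 1)) K}
    (habs : IsAbsIrreducible m) {k : ℕ} (hk : MonicIn0 m k) : k = 1 := by
  set L := AlgebraicClosure K
  have hk' := monicIn0_map (algebraMap K L) hk
  have hirr : Irreducible (MvPolynomial.map (algebraMap K L) m) := habs
  set q : (MvPolynomial (Fin 0) L)[X] := finSuccEquiv L 0 (MvPolynomial.map (algebraMap K L) m)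
    with hqdef
  have hq : Irreducible q := (MulEquiv.irreducible_iff (finSuccEquiv L 0).toMulEquiv).mpr hirr
  let e : MvPolynomial (Fin 0) L ≃+* L := (MvPolynomial.isEmptyAlgEquiv L (Fin 0)).toRingEquiv
  have hq' : Irreducible (q.map (e : MvPolynomial (Fin 0) L →+* L)) :=
    (MulEquiv.irreducible_iff (Polynomial.mapEquiv e).toMulEquiv).mpr hq
  have hdeg := IsAlgClosed.degree_eq_one_of_irreducible L hq'
  have hnat : (q.map (e : MvPolynomial (Fin 0) L →+* L)).natDegree = k := by
    rw [Polynomial.natDegree_map_eq_of_injective e.injective, hqdef, hk'.2]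
  rw [Polynomial.degree_eq_natDegree hq'.ne_zero, hnat] at hdeg
  exact_mod_cast hdeg

end AbsIrr

/-! ### Kaltofen's irreducibility forms, packaged -/

section Kaltofen

/-- A family of integer forms in the coefficients of polynomials of `N` variables detecting
"total degree `= D` and absolutely irreducible" over every field (Kaltofen's Theorem 7 for
`N, D ≥ 2`). [cite: Kaltofen1995, Thm. 7] -/
structure KForms (N D : ℕ) : Type 1 where
  /-- the index type of the forms -/
  ι : Type
  /-- finiteness of the index type -/
  [fι : Fintype ι]
  /-- the forms -/
  Φ : ι → MvPolynomial (Fin N →₀ ℕ) ℤ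
  /-- Kaltofen's equivalence -/
  spec : 2 ≤ N → 2 ≤ D → ∀ (K : Type) [Field K] (f : MvPolynomial (Fin N) K),
    f.totalDegree ≤ D → ((∀ t, MvPolynomial.aeval (fun e : Fin N →₀ ℕ => f.coeff e) (Φ t) = 0) ↔
      (f.totalDegree < D ∨ ¬ IsAbsIrreducible f))

/-- The index type of a family of Kaltofen forms is finite. [cite: Kaltofen1995, Thm. 7] -/
instance KForms.instFintypeι {N D : ℕ} (F : KForms N D) : Fintype F.ι := F.fι

/-- Kaltofen's forms exist (Theorem 7, proved in the tree as `kaltofen1995_thm7_holds`; a vacuous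
family when `N < 2` or `D < 2`). [cite: Kaltofen1995, Thm. 7] -/
theorem KForms.nonempty (N D : ℕ) : Nonempty (KForms N D) := by
  by_cases h : 2 ≤ N ∧ 2 ≤ D
  · obtain ⟨ι, hι, Φ, -, hΦ⟩ := kaltofen1995_thm7_holds N D h.1 h.2
    exact ⟨{ ι := ι, Φ := Φ, spec := fun _ _ K _ f hf => hΦ K f hf }⟩
  · exact ⟨{ ι := PEmpty, Φ := fun t => PEmpty.elim t, spec := fun hN hD => absurd ⟨hN, hD⟩ h }⟩

/-- A chosen family of Kaltofen forms. [cite: Kaltofen1995, Thm. 7] -/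
def kForms (N D : ℕ) : KForms N D := Classical.choice (KForms.nonempty N D)

variable {K : Type} [Field K] {d N : ℕ}

/-- **The absolute-irreducibility certificate** for a box of coefficients in `d + 1` variables,
monic of degree `k` in `X₀`: either `k = 1`, or `d ≥ 1` and, for some formal degree `D ≥ 2`
bounding the support, some Kaltofen form does not vanish. [cite: Kaltofen1995, Thm. 7] -/
def CertBox (cm : Box (d + 1) N → K) (k : ℕ) : Prop :=
  k = 1 ∨ (1 ≤ d ∧ ∃ D : Fin ((d + 1) * N + 1), 2 ≤ (D : ℕ) ∧
    (∀ β : Box (d + 1) N, (D : ℕ) < β.deg → cm β = 0) ∧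
      ∃ t : (kForms (d + 1) D).ι, MvPolynomial.aeval
        (fun e : Fin (d + 1) →₀ ℕ => (boxPoly cm).coeff e) ((kForms (d + 1) D).Φ t) ≠ 0)

/-- The degree of a box exponent is the degree of its exponent. [folklore] -/
theorem Box.sum_toExp_eq_deg {m : ℕ} (β : Box m N) : (β.toExp.sum fun _ k => k) = β.deg := by
  unfold Box.deg
  rw [Finsupp.sum_fintype]
  · simp only [Box.toExp_apply]
  · intro _; rfl

/-- An absolutely irreducible box polynomial, monic of degree `k ≥ 1` in `X₀`, has a certificate.
[cite: Kaltofen1995, Thm. 7] -/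
theorem certBox_of_isAbsIrreducible (cm : Box (d + 1) N → K) {k : ℕ} (hk1 : 1 ≤ k)
    (hmon : MonicIn0 (boxPoly cm) k) (habs : IsAbsIrreducible (boxPoly cm)) : CertBox cm k := by
  by_cases hk : k = 1
  · exact Or.inl hk
  right
  have hk2 : 2 ≤ k := by omega
  -- `d ≥ 1`: in one variable an absolutely irreducible monic polynomial is linear
  have hd : 1 ≤ d := by
    rcases Nat.eq_zero_or_pos d with h0 | hpos
    · subst h0
      exact absurd (eq_one_of_isAbsIrreducible_of_monicIn0 habs hmon) hk
    · exact hpos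
  refine ⟨hd, ?_⟩
  -- the formal degree `D = deg (boxPoly cm)`
  set D := (boxPoly cm).totalDegree with hD
  have hDle : D ≤ (d + 1) * N := totalDegree_boxPoly_le_mul cm
  have hkD : k ≤ D := by
    rw [← hmon.2, natDegree_finSuccEquiv]
    exact degreeOf_le_totalDegree _ _
  refine ⟨⟨D, Nat.lt_succ_of_le hDle⟩, le_trans hk2 hkD, fun β hβ => ?_, ?_⟩
  · rw [← coeff_boxPoly_toExp cm β, ← notMem_support_iff]
    intro hmem
    have h1 := le_totalDegree hmem
    rw [Box.sum_toExp_eq_deg] at h1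
    exact absurd (lt_of_lt_of_le hβ h1) (lt_irrefl _)
  · have hspec := (kForms (d + 1) D).spec (by omega) (le_trans hk2 hkD) K (boxPoly cm) le_rfl
    by_contra hall
    push Not at hall
    have h := hspec.mp hall
    rcases h with h | h
    · exact lt_irrefl _ h
    · exact h habs

/-- A certificate makes a box polynomial, monic in `X₀`, absolutely irreducible.
[cite: Kaltofen1995, Thm. 7] -/
theorem isAbsIrreducible_of_certBox (cm : Box (d + 1) N → K) {k : ℕ}
    (hmon : MonicIn0 (boxPoly cm) k) (hcert : CertBox cm k) : IsAbsIrreducible (boxPoly cm) := by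
  rcases hcert with rfl | ⟨hd, D, hD2, hsupp, t, ht⟩
  · exact isAbsIrreducible_of_monicIn0_one hmon
  · have hdeg : (boxPoly cm).totalDegree ≤ D := totalDegree_boxPoly_le_of_forall cm hsupp
    have hspec := (kForms (d + 1) D).spec (by omega) hD2 K (boxPoly cm) hdeg
    by_contra habs
    exact ht (hspec.mpr (Or.inr habs) t)

end Kaltofen

/-! ### Integer polynomials as ring terms -/

section Atoms

variable {α : Type}

/-- The ring term of an integer polynomial in the variables `α`. [folklore] -/
def termOfPoly (F : MvPolynomial α ℤ) : Language.ring.Term α :=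
  termOfFreeCommRing (MvPolynomial.eval₂Hom (Int.castRingHom (FreeCommRing α)) FreeCommRing.of F)

/-- The ring term of an integer polynomial realises its evaluation. [folklore] -/
theorem realize_termOfPoly {K : Type*} [CommRing K] [CompatibleRing K] (F : MvPolynomial α ℤ)
    (v : α → K) : (termOfPoly F).realize v = MvPolynomial.aeval v F := by
  rw [termOfPoly, realize_termOfFreeCommRing]
  have h : (FreeCommRing.lift v).comp
      (MvPolynomial.eval₂Hom (Int.castRingHom (FreeCommRing α)) FreeCommRing.of) =
        (MvPolynomial.aeval v : MvPolynomial α ℤ →ₐ[ℤ] K).toRingHom :=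
    MvPolynomial.ringHom_ext (fun n => by simp) (fun a => by simp)
  exact DFunLike.congr_fun h F

/-- "`F(v) = 0`" for an integer polynomial `F` is definable. [folklore] -/
theorem definable_aeval_eq_zero (F : MvPolynomial α ℤ) :
    ∃ θ : Language.ring.Formula α, ∀ (K : Type) [Field K] [CompatibleRing K] (v : α → K),
      θ.Realize v ↔ MvPolynomial.aeval v F = 0 :=
  ⟨Term.equal (termOfPoly F) 0, fun K _ _ v => by
    rw [Formula.realize_equal, realize_termOfPoly, realize_zero]⟩

/-- "`F(v) ≠ 0`" is definable. [folklore] -/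
theorem definable_aeval_ne_zero (F : MvPolynomial α ℤ) :
    ∃ θ : Language.ring.Formula α, ∀ (K : Type) [Field K] [CompatibleRing K] (v : α → K),
      θ.Realize v ↔ MvPolynomial.aeval v F ≠ 0 :=
  definable_not (definable_aeval_eq_zero F)

/-- Transport of definability along a pointwise equivalence of predicates. [folklore] -/
theorem definable_congr {P Q : ∀ (K : Type) [Field K] [CompatibleRing K], (α → K) → Prop}
    (hPQ : ∀ (K : Type) [Field K] [CompatibleRing K] (v : α → K), P K v ↔ Q K v)
    (hP : ∃ θ : Language.ring.Formula α, ∀ (K : Type) [Field K] [CompatibleRing K] (v : α → K),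
      θ.Realize v ↔ P K v) :
    ∃ θ : Language.ring.Formula α, ∀ (K : Type) [Field K] [CompatibleRing K] (v : α → K),
      θ.Realize v ↔ Q K v := by
  obtain ⟨θ, hθ⟩ := hP
  exact ⟨θ, fun K _ _ v => (hθ K v).trans (hPQ K v)⟩

/-- A constant proposition is definable. [folklore] -/
theorem definable_const (p : Prop) :
    ∃ θ : Language.ring.Formula α, ∀ (K : Type) [Field K] [CompatibleRing K] (v : α → K),
      θ.Realize v ↔ p := by
  by_cases hp : p
  · exact ⟨⊤, fun _ _ _ _ => by simp [hp]⟩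
  · exact ⟨⊥, fun _ _ _ _ => by simp [hp, Formula.Realize]⟩

/-- "`v a = 0`" is definable. [folklore] -/
theorem definable_var_eq_zero (a : α) :
    ∃ θ : Language.ring.Formula α, ∀ (K : Type) [Field K] [CompatibleRing K] (v : α → K),
      θ.Realize v ↔ v a = 0 :=
  definable_congr (fun K _ _ v => by rw [Term.realize_var, realize_zero])
    (definable_termEq (Term.var a) 0)

/-- "`v a = 1`" is definable. [folklore] -/
theorem definable_var_eq_one (a : α) :
    ∃ θ : Language.ring.Formula α, ∀ (K : Type) [Field K] [CompatibleRing K] (v : α → K),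
      θ.Realize v ↔ v a = 1 :=
  definable_congr (fun K _ _ v => by rw [Term.realize_var, realize_one])
    (definable_termEq (Term.var a) 1)

end Atoms

/-! ### Generic terms: box polynomials applied to terms -/

section Terms

variable {V : Type} {m N : ℕ}

/-- The integer polynomial "box polynomial with coefficient VARIABLES `cv` applied to the
argument polynomials `args`". [folklore] -/
def boxApp (cv : Box m N → V) (args : Fin m → MvPolynomial V ℤ) : MvPolynomial V ℤ :=
  ∑ β, X (cv β) * ∏ l, args l ^ (β l : ℕ)

/-- Evaluation of `boxApp`. [folklore] -/
theorem aeval_boxApp {K : Type*} [CommRing K] (u : V → K) (cv : Box m N → V)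
    (args : Fin m → MvPolynomial V ℤ) :
    MvPolynomial.aeval u (boxApp cv args) =
      eval (fun l => MvPolynomial.aeval u (args l)) (boxPoly (u ∘ cv)) := by
  simp only [boxApp, map_sum, map_mul, map_prod, map_pow, aeval_X, eval_boxPoly,
    Function.comp_apply]

/-- The integer polynomial "the form `Φ` in the coefficient variables `cv`" (variables of `Φ`
outside the box are set to `0`). [folklore] -/
def certPoly (cv : Box m N → V) (Φ : MvPolynomial (Fin m →₀ ℕ) ℤ) : MvPolynomial V ℤ :=
  MvPolynomial.bind₁ (fun e : Fin m →₀ ℕ => if h : ∀ l, e l ≤ N then X (cv (Box.ofExp e h)) else 0) Φ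

/-- Evaluation of `certPoly`. [folklore] -/
theorem aeval_certPoly {K : Type*} [CommRing K] (u : V → K) (cv : Box m N → V)
    (Φ : MvPolynomial (Fin m →₀ ℕ) ℤ) :
    MvPolynomial.aeval u (certPoly cv Φ) =
      MvPolynomial.aeval (fun e : Fin m →₀ ℕ => (boxPoly (u ∘ cv)).coeff e) Φ := by
  rw [certPoly, aeval_bind₁]
  have hfun : (fun e : Fin m →₀ ℕ => MvPolynomial.aeval u
      (if h : ∀ l, e l ≤ N then (X (cv (Box.ofExp e h)) : MvPolynomial V ℤ) else 0)) =
      fun e => (boxPoly (u ∘ cv)).coeff e := by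
    funext e
    rw [coeff_boxPoly]
    split_ifs with h
    · rw [aeval_X, Function.comp_apply]
    · rw [map_zero]
  rw [hfun]

end Terms

/-! ### Shape variables and the semantic shape condition -/

section Shape

/-- The coefficient variables of a candidate decomposition of shape `(n, B, d, μ, L)`: the box
coefficients of `T_{ik}, U_i, m_i, δ_i, w_{ij}` and of the charts `T'_{lk}, N_{lj}`. [folklore] -/
inductive ShapeVar (n B d μ L : ℕ) : Type
  | T (i : Fin μ) (k : Fin d) (β : Box n B)
  | U (i : Fin μ) (β : Box n B)
  | m (i : Fin μ) (β : Box (d + 1) B)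
  | δ (i : Fin μ) (β : Box d B)
  | w (i : Fin μ) (j : Fin n) (β : Box (d + 1) B)
  | T' (l : Fin L) (k : Fin (d - 1)) (β : Box n B)
  | N (l : Fin L) (j : Fin n) (β : Box (d - 1 + 1) B)
  deriving Fintype

variable {n B d μ L : ℕ} {K : Type} [Field K]

/-- The piece with the given coefficients. [folklore] -/
def pieceOf (w : ShapeVar n B d μ L → K) (i : Fin μ) : Piece K n d where
  T := fun k => boxPoly fun β => w (.T i k β)
  U := boxPoly fun β => w (.U i β)
  m := boxPoly fun β => w (.m i β)
  δ := boxPoly fun β => w (.δ i β)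
  w := fun j => boxPoly fun β => w (.w i j β)

/-- The chart with the given coefficients. [folklore] -/
def chartOf (w : ShapeVar n B d μ L → K) (l : Fin L) : Chart K n (d - 1) where
  T := fun k => boxPoly fun β => w (.T' l k β)
  N := fun j => boxPoly fun β => w (.N l j β)

/-- The polynomial system with the given coefficients. [folklore] -/
def fOf {r e : ℕ} (c : Fin r × Box n e → K) (s : Fin r) : MvPolynomial (Fin n) K :=
  boxPoly fun β => c (s, β)

variable (n B d μ L)

/-- **The semantic shape condition** on the coefficients `c` of the system and the shape
coefficients `w`: monicity and certificates of the `m_i`, monicity of the chart equations,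
`δ_i ≠ 0`, and the clauses (a)–(d) of a decomposition for the pieces and charts with
coefficients `w`. [folklore] -/
def CondSem (r e : ℕ) (K : Type) [Field K] (c : Fin r × Box n e → K)
    (w : ShapeVar n B d μ L → K) : Prop :=
  (∀ i : Fin μ, ∃ k : Fin (B + 1), 1 ≤ (k : ℕ) ∧ MonicBox (fun β => w (.m i β)) k ∧
    CertBox (fun β => w (.m i β)) k) ∧
  (∀ (l : Fin L) (j : Fin n), ∃ k : Fin (B + 1), 1 ≤ (k : ℕ) ∧ MonicBox (fun β => w (.N l j β)) k) ∧
  (∀ i : Fin μ, ∃ β : Box d B, w (.δ i β) ≠ 0) ∧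
  (∀ (i : Fin μ) (x : Fin n → K), (pieceOf w i).Mem x → ∀ s, eval x (fOf c s) = 0) ∧
  (∀ x : Fin n → K, (∀ s, eval x (fOf c s) = 0) →
    (∃ l, (chartOf w l).Mem x) ∨ ∃ i, (pieceOf w i).Mem x) ∧
  (∀ i i' : Fin μ, i ≠ i' → ∀ x : Fin n → K, (pieceOf w i).Mem x → (pieceOf w i').Mem x →
    ∃ l, (chartOf w l).Mem x) ∧
  (∀ i : Fin μ, (pieceOf w i).Param)

variable {n B d μ L}

/-! Term-level versions of the parameters and the lifted point. -/

section PieceTerms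

variable {V : Type} (ιs : ShapeVar n B d μ L → V)

/-- Terms for the parameters `T_i(x)`. [folklore] -/
def parT (i : Fin μ) (xs : Fin n → MvPolynomial V ℤ) (k : Fin d) : MvPolynomial V ℤ :=
  boxApp (fun β => ιs (.T i k β)) xs

/-- Terms for the lifted point `(U_i(x), T_i(x))`. [folklore] -/
def liftT (i : Fin μ) (xs : Fin n → MvPolynomial V ℤ) : Fin (d + 1) → MvPolynomial V ℤ :=
  Fin.cons (boxApp (fun β => ιs (.U i β)) xs) (parT ιs i xs)

/-- Terms for the chart parameters. [folklore] -/
def cparT (l : Fin L) (xs : Fin n → MvPolynomial V ℤ) (k : Fin (d - 1)) : MvPolynomial V ℤ :=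
  boxApp (fun β => ιs (.T' l k β)) xs

variable {ιs}

/-- Evaluation of `parT`. [folklore] -/
theorem aeval_parT (u : V → K) (i : Fin μ) (xs : Fin n → MvPolynomial V ℤ) :
    (fun k => MvPolynomial.aeval u (parT ιs i xs k)) =
      (pieceOf (u ∘ ιs) i).par fun l => MvPolynomial.aeval u (xs l) := by
  funext k
  simp only [parT, aeval_boxApp, pieceOf, Piece.par]
  rfl

/-- Evaluation of `liftT`. [folklore] -/
theorem aeval_liftT (u : V → K) (i : Fin μ) (xs : Fin n → MvPolynomial V ℤ) :
    (fun t => MvPolynomial.aeval u (liftT ιs i xs t)) =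
      (pieceOf (u ∘ ιs) i).lift fun l => MvPolynomial.aeval u (xs l) := by
  unfold liftT Piece.lift
  rw [← aeval_parT u i xs]
  funext t
  refine Fin.cases ?_ (fun k => ?_) t
  · simp only [Fin.cons_zero, aeval_boxApp, pieceOf]
    rfl
  · simp only [Fin.cons_succ]

/-- Evaluation of `cparT`. [folklore] -/
theorem aeval_cparT (u : V → K) (l : Fin L) (xs : Fin n → MvPolynomial V ℤ) :
    (fun k => MvPolynomial.aeval u (cparT ιs l xs k)) =
      (chartOf (u ∘ ιs) l).par fun j => MvPolynomial.aeval u (xs j) := by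
  funext k
  simp only [cparT, aeval_boxApp, chartOf, Chart.par]
  rfl

end PieceTerms

end Shape

/-! ### Definability of the shape condition -/

section Definability

variable {n B d μ L N : ℕ}

/-- Composing `aeval` with `Fin.cons` of terms. [folklore] -/
theorem aeval_comp_cons {V : Type} {K : Type*} [CommRing K] (u : V → K) {m' : ℕ}
    (a : MvPolynomial V ℤ) (q : Fin m' → MvPolynomial V ℤ) :
    (fun t => MvPolynomial.aeval u ((Fin.cons a q : Fin (m' + 1) → MvPolynomial V ℤ) t)) =
      Fin.cons (MvPolynomial.aeval u a) fun k => MvPolynomial.aeval u (q k) := by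
  funext t
  refine Fin.cases ?_ (fun k => ?_) t
  · simp only [Fin.cons_zero]
  · simp only [Fin.cons_succ]

/-- `MonicBox` on coefficient variables is definable. [folklore] -/
theorem definable_monicBox {α : Type} (cv : Box (d + 1) N → α) (k : ℕ) :
    ∃ θ : Language.ring.Formula α, ∀ (K : Type) [Field K] [CompatibleRing K] (v : α → K),
      θ.Realize v ↔ MonicBox (fun β => v (cv β)) k := by
  unfold MonicBox
  refine definable_and (definable_iInf fun β => definable_imp (definable_const _)
    (definable_var_eq_zero _)) (definable_iInf fun β => definable_imp (definable_const _) ?_)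
  by_cases h : ∀ l : Fin d, (β l.succ : ℕ) = 0
  · refine definable_congr (fun K _ _ v => ?_) (definable_var_eq_one (cv β))
    rw [if_pos h]
  · refine definable_congr (fun K _ _ v => ?_) (definable_var_eq_zero (cv β))
    rw [if_neg h]

/-- `CertBox` on coefficient variables is definable. [folklore] -/
theorem definable_certBox {α : Type} (cv : Box (d + 1) N → α) (k : ℕ) :
    ∃ θ : Language.ring.Formula α, ∀ (K : Type) [Field K] [CompatibleRing K] (v : α → K),
      θ.Realize v ↔ CertBox (fun β => v (cv β)) k := by
  unfold CertBox
  refine definable_or (definable_const _) (definable_and (definable_const _)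
    (definable_iSup fun D => definable_and (definable_const _) (definable_and
      (definable_iInf fun β => definable_imp (definable_const _) (definable_var_eq_zero _))
      (definable_iSup fun t => ?_))))
  refine definable_congr (fun K _ _ v => ?_) (definable_aeval_ne_zero (certPoly cv ((kForms (d + 1) D).Φ t)))
  rw [aeval_certPoly]
  rfl

variable {V : Type} (ιs : ShapeVar n B d μ L → V)

/-- Membership in a piece (coefficients = variables, point = terms) is definable. [folklore] -/
theorem definable_pieceMem (i : Fin μ) (xs : Fin n → MvPolynomial V ℤ) :
    ∃ θ : Language.ring.Formula V, ∀ (K : Type) [Field K] [CompatibleRing K] (u : V → K),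
      θ.Realize u ↔ (pieceOf (u ∘ ιs) i).Mem fun l => MvPolynomial.aeval u (xs l) := by
  let F1 : MvPolynomial V ℤ := boxApp (fun β => ιs (.δ i β)) (parT ιs i xs)
  let F2 : MvPolynomial V ℤ := boxApp (fun β => ιs (.m i β)) (liftT ιs i xs)
  let F3 : Fin n → MvPolynomial V ℤ := fun j => F1 * xs j - boxApp (fun β => ιs (.w i j β)) (liftT ιs i xs)
  have key : ∀ (K : Type) [Field K] [CompatibleRing K] (u : V → K),
      (MvPolynomial.aeval u F1 ≠ 0 ∧ MvPolynomial.aeval u F2 = 0 ∧ ∀ j, MvPolynomial.aeval u (F3 j) = 0) ↔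
        (pieceOf (u ∘ ιs) i).Mem fun l => MvPolynomial.aeval u (xs l) := by
    intro K _ _ u
    have h1 : MvPolynomial.aeval u F1 =
        eval ((pieceOf (u ∘ ιs) i).par fun l => MvPolynomial.aeval u (xs l)) (pieceOf (u ∘ ιs) i).δ := by
      simp only [F1, aeval_boxApp, aeval_parT]
      rfl
    have h2 : MvPolynomial.aeval u F2 =
        eval ((pieceOf (u ∘ ιs) i).lift fun l => MvPolynomial.aeval u (xs l)) (pieceOf (u ∘ ιs) i).m := by
      simp only [F2, aeval_boxApp, aeval_liftT]
      rfl
    have h3 : ∀ j, MvPolynomial.aeval u (F3 j) =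
        eval ((pieceOf (u ∘ ιs) i).par fun l => MvPolynomial.aeval u (xs l)) (pieceOf (u ∘ ιs) i).δ *
          MvPolynomial.aeval u (xs j) -
        eval ((pieceOf (u ∘ ιs) i).lift fun l => MvPolynomial.aeval u (xs l)) ((pieceOf (u ∘ ιs) i).w j) := by
      intro j
      simp only [F3, map_sub, map_mul, h1, aeval_boxApp, aeval_liftT]
      rfl
    simp only [Piece.Mem, h1, h2, h3, sub_eq_zero]
  exact definable_congr key (definable_and (definable_aeval_ne_zero F1)
    (definable_and (definable_aeval_eq_zero F2) (definable_iInf fun j => definable_aeval_eq_zero (F3 j))))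

/-- Membership in a chart is definable. [folklore] -/
theorem definable_chartMem (l : Fin L) (xs : Fin n → MvPolynomial V ℤ) :
    ∃ θ : Language.ring.Formula V, ∀ (K : Type) [Field K] [CompatibleRing K] (u : V → K),
      θ.Realize u ↔ (chartOf (u ∘ ιs) l).Mem fun j => MvPolynomial.aeval u (xs j) := by
  let G : Fin n → MvPolynomial V ℤ := fun j =>
    boxApp (fun β => ιs (.N l j β)) (Fin.cons (xs j) (cparT ιs l xs))
  have key : ∀ (K : Type) [Field K] [CompatibleRing K] (u : V → K),
      (∀ j, MvPolynomial.aeval u (G j) = 0) ↔ (chartOf (u ∘ ιs) l).Mem fun j => MvPolynomial.aeval u (xs j) := by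
    intro K _ _ u
    refine forall_congr' fun j => ?_
    simp only [G, aeval_boxApp, aeval_comp_cons, aeval_cparT]
    rfl
  exact definable_congr key (definable_iInf fun j => definable_aeval_eq_zero (G j))

/-- The parametrisation property of a piece at given `(y, v, x)`. [folklore] -/
def _root_.Literature.NumberTheory.DiophantineGeometry.Piece.ParamAt {K : Type} [Field K]
    (p : Piece K n d) (y : Fin d → K) (v : K) (x : Fin n → K) : Prop :=
  eval (Fin.cons v y : Fin (d + 1) → K) p.m = 0 → eval y p.δ ≠ 0 →
    (∀ j, eval y p.δ * x j = eval (Fin.cons v y : Fin (d + 1) → K) (p.w j)) →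
      p.par x = y ∧ eval x p.U = v

/-- `Param` is `ParamAt` everywhere. [folklore] -/
theorem _root_.Literature.NumberTheory.DiophantineGeometry.Piece.param_iff {K : Type} [Field K]
    (p : Piece K n d) : p.Param ↔ ∀ y v x, p.ParamAt y v x := Iff.rfl

/-- The block of new variables for the parametrisation property: `y`, `v`, `x`. [folklore] -/
abbrev ParamBlock (d n : ℕ) : Type := Fin d ⊕ Fin 1 ⊕ Fin n

/-- The parametrisation property at the variables of a block is definable. [folklore] -/
theorem definable_paramAt (i : Fin μ) :
    ∃ θ : Language.ring.Formula (V ⊕ ParamBlock d n),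
      ∀ (K : Type) [Field K] [CompatibleRing K] (u : V ⊕ ParamBlock d n → K),
        θ.Realize u ↔ (pieceOf ((fun a => u (Sum.inl a)) ∘ ιs) i).ParamAt
          (fun k => u (Sum.inr (Sum.inl k))) (u (Sum.inr (Sum.inr (Sum.inl 0))))
          (fun j => u (Sum.inr (Sum.inr (Sum.inr j)))) := by
  -- the terms
  let ιs' : ShapeVar n B d μ L → V ⊕ ParamBlock d n := fun s => Sum.inl (ιs s)
  let ys : Fin d → MvPolynomial (V ⊕ ParamBlock d n) ℤ := fun k => X (Sum.inr (Sum.inl k))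
  let vT : MvPolynomial (V ⊕ ParamBlock d n) ℤ := X (Sum.inr (Sum.inr (Sum.inl 0)))
  let xs : Fin n → MvPolynomial (V ⊕ ParamBlock d n) ℤ := fun j => X (Sum.inr (Sum.inr (Sum.inr j)))
  let A : MvPolynomial (V ⊕ ParamBlock d n) ℤ := boxApp (fun β => ιs' (.m i β)) (Fin.cons vT ys)
  let Bt : MvPolynomial (V ⊕ ParamBlock d n) ℤ := boxApp (fun β => ιs' (.δ i β)) ys
  let C : Fin n → MvPolynomial (V ⊕ ParamBlock d n) ℤ := fun j =>
    Bt * xs j - boxApp (fun β => ιs' (.w i j β)) (Fin.cons vT ys)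
  let Dt : Fin d → MvPolynomial (V ⊕ ParamBlock d n) ℤ := fun k => parT ιs' i xs k - ys k
  let E : MvPolynomial (V ⊕ ParamBlock d n) ℤ := boxApp (fun β => ιs' (.U i β)) xs - vT
  have key : ∀ (K : Type) [Field K] [CompatibleRing K] (u : V ⊕ ParamBlock d n → K),
      (MvPolynomial.aeval u A = 0 → MvPolynomial.aeval u Bt ≠ 0 → (∀ j, MvPolynomial.aeval u (C j) = 0) →
        (∀ k, MvPolynomial.aeval u (Dt k) = 0) ∧ MvPolynomial.aeval u E = 0) ↔
      (pieceOf ((fun a => u (Sum.inl a)) ∘ ιs) i).ParamAt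
          (fun k => u (Sum.inr (Sum.inl k))) (u (Sum.inr (Sum.inr (Sum.inl 0))))
          (fun j => u (Sum.inr (Sum.inr (Sum.inr j)))) := by
    intro K _ _ u
    have hys : (fun k => MvPolynomial.aeval u (ys k)) = fun k => u (Sum.inr (Sum.inl k)) := by
      funext k; exact aeval_X _ _
    have hxs : (fun j => MvPolynomial.aeval u (xs j)) = fun j => u (Sum.inr (Sum.inr (Sum.inr j))) := by
      funext j; exact aeval_X _ _
    have hv : MvPolynomial.aeval u vT = u (Sum.inr (Sum.inr (Sum.inl 0))) := aeval_X _ _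
    have hcomp : (u ∘ ιs') = ((fun a => u (Sum.inl a)) ∘ ιs) := rfl
    have hA : MvPolynomial.aeval u A = eval (Fin.cons (u (Sum.inr (Sum.inr (Sum.inl 0))))
        (fun k => u (Sum.inr (Sum.inl k))) : Fin (d + 1) → K)
        (pieceOf ((fun a => u (Sum.inl a)) ∘ ιs) i).m := by
      simp only [A, aeval_boxApp, aeval_comp_cons, hys, hv]
      rfl
    have hB : MvPolynomial.aeval u Bt = eval (fun k => u (Sum.inr (Sum.inl k)))
        (pieceOf ((fun a => u (Sum.inl a)) ∘ ιs) i).δ := by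
      simp only [Bt, aeval_boxApp, hys]
      rfl
    have hC : ∀ j, MvPolynomial.aeval u (C j) =
        eval (fun k => u (Sum.inr (Sum.inl k))) (pieceOf ((fun a => u (Sum.inl a)) ∘ ιs) i).δ *
          u (Sum.inr (Sum.inr (Sum.inr j))) -
        eval (Fin.cons (u (Sum.inr (Sum.inr (Sum.inl 0)))) (fun k => u (Sum.inr (Sum.inl k))) :
          Fin (d + 1) → K) ((pieceOf ((fun a => u (Sum.inl a)) ∘ ιs) i).w j) := by
      intro j
      simp only [C, map_sub, map_mul, hB, aeval_boxApp, aeval_comp_cons, hys, hv, xs, aeval_X]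
      rfl
    have hD : ∀ k, MvPolynomial.aeval u (Dt k) =
        (pieceOf ((fun a => u (Sum.inl a)) ∘ ιs) i).par (fun j => u (Sum.inr (Sum.inr (Sum.inr j)))) k -
          u (Sum.inr (Sum.inl k)) := by
      intro k
      simp only [Dt, map_sub, ys, aeval_X]
      congr 1
      have h := congrFun (aeval_parT (ιs := ιs') u i xs) k
      simp only [hxs, hcomp] at h
      exact h
    have hE : MvPolynomial.aeval u E =
        eval (fun j => u (Sum.inr (Sum.inr (Sum.inr j)))) (pieceOf ((fun a => u (Sum.inl a)) ∘ ιs) i).U -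
          u (Sum.inr (Sum.inr (Sum.inl 0))) := by
      simp only [E, map_sub, aeval_boxApp, hxs, hv]
      rfl
    simp only [Piece.ParamAt, hA, hB, hC, hD, hE, sub_eq_zero, funext_iff]
  exact definable_congr key (definable_imp (definable_aeval_eq_zero A) (definable_imp
    (definable_aeval_ne_zero Bt) (definable_imp (definable_iInf fun j => definable_aeval_eq_zero (C j))
      (definable_and (definable_iInf fun k => definable_aeval_eq_zero (Dt k)) (definable_aeval_eq_zero E)))))

/-- The parametrisation property of a piece is definable. [folklore] -/
theorem definable_param (i : Fin μ) :
    ∃ θ : Language.ring.Formula V, ∀ (K : Type) [Field K] [CompatibleRing K] (u : V → K),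
      θ.Realize u ↔ (pieceOf (u ∘ ιs) i).Param := by
  have h := definable_forall (α := V) (β := ParamBlock d n)
    (P := fun K _ _ u b => (pieceOf (u ∘ ιs) i).ParamAt (fun k => b (Sum.inl k))
      (b (Sum.inr (Sum.inl 0))) (fun j => b (Sum.inr (Sum.inr j)))) (definable_paramAt ιs i)
  refine definable_congr (fun K _ _ u => ?_) h
  rw [Piece.param_iff]
  constructor
  · intro hall y v x
    have := hall (Sum.elim y (Sum.elim (fun _ => v) x))
    simpa using this
  · intro hall b
    exact hall _ _ _

variable (n B d μ L)

/-- **The shape condition is definable**: one ring formula in the coefficients of the system and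
the shape coefficients. [folklore] -/
theorem definable_condSem (r e : ℕ) :
    ∃ θ : Language.ring.Formula ((Fin r × Box n e) ⊕ ShapeVar n B d μ L),
      ∀ (K : Type) [Field K] [CompatibleRing K] (u : (Fin r × Box n e) ⊕ ShapeVar n B d μ L → K),
        θ.Realize u ↔ CondSem n B d μ L r e K (fun a => u (Sum.inl a)) (fun b => u (Sum.inr b)) := by
  unfold CondSem
  refine definable_and ?_ (definable_and ?_ (definable_and ?_ (definable_and ?_
    (definable_and ?_ (definable_and ?_ ?_)))))
  · -- monicity and certificates of the `m_i`
    exact definable_iInf fun i => definable_iSup fun k => definable_and (definable_const _)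
      (definable_and (definable_monicBox (fun β => Sum.inr (ShapeVar.m i β)) k)
        (definable_certBox (fun β => Sum.inr (ShapeVar.m i β)) k))
  · -- monicity of the chart equations
    exact definable_iInf fun l => definable_iInf fun j => definable_iSup fun k =>
      definable_and (definable_const _) (definable_monicBox (fun β => Sum.inr (ShapeVar.N l j β)) k)
  · -- `δ_i ≠ 0`
    exact definable_iInf fun i => definable_iSup fun β =>
      definable_not (definable_var_eq_zero (Sum.inr (ShapeVar.δ i β)))
  · -- (a)
    refine definable_iInf fun i => definable_forall (definable_imp ?_ (definable_iInf fun s => ?_))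
    · refine definable_congr (fun K _ _ v => ?_)
        (definable_pieceMem (fun b => Sum.inl (Sum.inr b)) i (fun l => X (Sum.inr l)))
      simp only [aeval_X]
      rfl
    · refine definable_congr (fun K _ _ v => ?_)
        (definable_aeval_eq_zero (boxApp (fun β => Sum.inl (Sum.inl (s, β))) (fun l => X (Sum.inr l))))
      rw [aeval_boxApp]
      simp only [aeval_X]
      rfl
  · -- (b)
    refine definable_forall (definable_imp (definable_iInf fun s => ?_)
      (definable_or (definable_iSup fun l => ?_) (definable_iSup fun i => ?_)))
    · refine definable_congr (fun K _ _ v => ?_)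
        (definable_aeval_eq_zero (boxApp (fun β => Sum.inl (Sum.inl (s, β))) (fun l => X (Sum.inr l))))
      rw [aeval_boxApp]
      simp only [aeval_X]
      rfl
    · refine definable_congr (fun K _ _ v => ?_)
        (definable_chartMem (fun b => Sum.inl (Sum.inr b)) l (fun j => X (Sum.inr j)))
      simp only [aeval_X]
      rfl
    · refine definable_congr (fun K _ _ v => ?_)
        (definable_pieceMem (fun b => Sum.inl (Sum.inr b)) i (fun l => X (Sum.inr l)))
      simp only [aeval_X]
      rfl
  · -- (c)
    refine definable_iInf fun i => definable_iInf fun i' => definable_imp (definable_const _)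
      (definable_forall (definable_imp ?_ (definable_imp ?_ (definable_iSup fun l => ?_))))
    · refine definable_congr (fun K _ _ v => ?_)
        (definable_pieceMem (fun b => Sum.inl (Sum.inr b)) i (fun l => X (Sum.inr l)))
      simp only [aeval_X]
      rfl
    · refine definable_congr (fun K _ _ v => ?_)
        (definable_pieceMem (fun b => Sum.inl (Sum.inr b)) i' (fun l => X (Sum.inr l)))
      simp only [aeval_X]
      rfl
    · refine definable_congr (fun K _ _ v => ?_)
        (definable_chartMem (fun b => Sum.inl (Sum.inr b)) l (fun j => X (Sum.inr j)))
      simp only [aeval_X]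
      rfl
  · -- (d)
    exact definable_iInf fun i => definable_param (fun b => Sum.inr b) i

variable {d μ L}

/-- The finite set of shapes `(d, μ, L)` of complexity `≤ B`: `d ≤ n`, `1 ≤ μ ≤ B`, `L ≤ B`,
`L = 0` if `d = 0`. [folklore] -/
abbrev ShapeIdx (n B : ℕ) : Type :=
  {σ : Fin (n + 1) × Fin (B + 1) × Fin (B + 1) // 1 ≤ (σ.2.1 : ℕ) ∧ ((σ.1 : ℕ) = 0 → (σ.2.2 : ℕ) = 0)}

/-- **The semantic transfer statement** for complexity `B`: the system with coefficients `c` has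
no rational zero, or some shape of complexity `≤ B` and some shape coefficients satisfy the shape
condition. [folklore] -/
def SemB (r e : ℕ) (K : Type) [Field K] (c : Fin r × Box n e → K) : Prop :=
  (¬ ∃ x : Fin n → K, ∀ s, eval x (fOf c s) = 0) ∨
    ∃ σ : ShapeIdx n B, ∃ w : ShapeVar n B σ.1.1 σ.1.2.1 σ.1.2.2 → K,
      CondSem n B σ.1.1 σ.1.2.1 σ.1.2.2 r e K c w

/-- `SemB` is definable by one ring formula in the coefficients. [folklore] -/
theorem exists_formula_semB (r e : ℕ) :
    ∃ θ : Language.ring.Formula (Fin r × Box n e),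
      ∀ (K : Type) [Field K] [CompatibleRing K] (c : Fin r × Box n e → K),
        θ.Realize c ↔ SemB n B r e K c := by
  unfold SemB
  refine definable_or (definable_not (definable_exists (definable_iInf fun s => ?_)))
    (definable_iSup fun σ => definable_exists ?_)
  · refine definable_congr (fun K _ _ v => ?_)
      (definable_aeval_eq_zero (boxApp (fun β => Sum.inl (s, β)) (fun l => X (Sum.inr l))))
    rw [aeval_boxApp]
    simp only [aeval_X]
    rfl
  · exact definable_condSem n B σ.1.1 σ.1.2.1 σ.1.2.2 r e

end Definability

/-! ### From decompositions to the shape condition and back -/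

section Bridges

variable {n B d r e : ℕ} {K : Type} [Field K]

/-- Field-wise equality of pieces. [folklore] -/
theorem Piece.ext' {p q : Piece K n d} (hT : p.T = q.T) (hU : p.U = q.U) (hm : p.m = q.m)
    (hδ : p.δ = q.δ) (hw : p.w = q.w) : p = q := by
  cases p; cases q; cases hT; cases hU; cases hm; cases hδ; cases hw; rfl

/-- Field-wise equality of charts. [folklore] -/
theorem Chart.ext' {d' : ℕ} {p q : Chart K n d'} (hT : p.T = q.T) (hN : p.N = q.N) : p = q := by
  cases p; cases q; cases hT; cases hN; rfl

variable {V : Set (Fin n → K)}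

/-- The coefficient valuation of a decomposition. [folklore] -/
def coeffVal (𝒟 : Decomposition K n V B) : ShapeVar n B 𝒟.d 𝒟.μ 𝒟.L → K
  | .T i k β => ((𝒟.piece i).T k).coeff β.toExp
  | .U i β => (𝒟.piece i).U.coeff β.toExp
  | .m i β => (𝒟.piece i).m.coeff β.toExp
  | .δ i β => (𝒟.piece i).δ.coeff β.toExp
  | .w i j β => ((𝒟.piece i).w j).coeff β.toExp
  | .T' l k β => ((𝒟.chart l).T k).coeff β.toExp
  | .N l j β => ((𝒟.chart l).N j).coeff β.toExp

/-- The pieces of the coefficient valuation are the pieces of the decomposition. [folklore] -/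
theorem pieceOf_coeffVal (𝒟 : Decomposition K n V B) (i : Fin 𝒟.μ) :
    pieceOf (coeffVal 𝒟) i = 𝒟.piece i := by
  obtain ⟨hT, hU, hm, hδ, hw⟩ := 𝒟.piece_degLE i
  exact Piece.ext' (funext fun k => boxPoly_coeff_eq (hT k)) (boxPoly_coeff_eq hU)
    (boxPoly_coeff_eq hm) (boxPoly_coeff_eq hδ) (funext fun j => boxPoly_coeff_eq (hw j))

/-- The charts of the coefficient valuation are the charts of the decomposition. [folklore] -/
theorem chartOf_coeffVal (𝒟 : Decomposition K n V B) (l : Fin 𝒟.L) :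
    chartOf (coeffVal 𝒟) l = 𝒟.chart l := by
  obtain ⟨hT, hN⟩ := 𝒟.chart_degLE l
  exact Chart.ext' (funext fun k => boxPoly_coeff_eq (hT k)) (funext fun j => boxPoly_coeff_eq (hN j))

/-- The degree in `X₀` of a polynomial monic in `X₀` is at most its total degree. [folklore] -/
theorem le_of_monicIn0 {m : MvPolynomial (Fin (d + 1)) K} {k : ℕ} (h : MonicIn0 m k) :
    k ≤ m.totalDegree := by
  rw [← h.2, natDegree_finSuccEquiv]
  exact degreeOf_le_totalDegree _ _

/-- **A decomposition yields the shape condition** (with its own complexity). [folklore] -/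
theorem semB_of_decomposition (c : Fin r × Box n e → K)
    (hV : V = {x | ∀ s, eval x (fOf c s) = 0}) (𝒟 : Decomposition K n V B) : SemB n B r e K c := by
  right
  refine ⟨⟨(⟨𝒟.d, Nat.lt_succ_of_le 𝒟.d_le⟩, ⟨𝒟.μ, Nat.lt_succ_of_le 𝒟.μ_le⟩,
    ⟨𝒟.L, Nat.lt_succ_of_le 𝒟.L_le⟩), 𝒟.one_le_μ, 𝒟.L_eq_zero⟩, coeffVal 𝒟, ?_⟩
  show CondSem n B 𝒟.d 𝒟.μ 𝒟.L r e K c (coeffVal 𝒟)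
  refine ⟨fun i => ?_, fun l j => ?_, fun i => ?_, fun i x hx s => ?_, fun x hx => ?_,
    fun i i' hii' x hi hi' => ?_, fun i => ?_⟩
  · obtain ⟨k, hk1, hmon⟩ := 𝒟.piece_monic i
    have hkB : k ≤ B := (le_of_monicIn0 hmon).trans (𝒟.piece_degLE i).2.2.1
    have hbox : boxPoly (fun β => coeffVal 𝒟 (.m i β)) = (𝒟.piece i).m :=
      boxPoly_coeff_eq (𝒟.piece_degLE i).2.2.1
    refine ⟨⟨k, Nat.lt_succ_of_le hkB⟩, hk1, ?_, ?_⟩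
    · show MonicBox (fun β => coeffVal 𝒟 (.m i β)) k
      rw [← monicIn0_boxPoly_iff _ hkB, hbox]
      exact hmon
    · show CertBox (fun β => coeffVal 𝒟 (.m i β)) k
      refine certBox_of_isAbsIrreducible _ hk1 ?_ ?_
      · rw [hbox]; exact hmon
      · rw [hbox]; exact 𝒟.isAbsIrreducible i
  · obtain ⟨k, hk1, hmon⟩ := 𝒟.chart_monic l j
    have hkB : k ≤ B := (le_of_monicIn0 hmon).trans ((𝒟.chart_degLE l).2 j)
    have hbox : boxPoly (fun β => coeffVal 𝒟 (.N l j β)) = (𝒟.chart l).N j :=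
      boxPoly_coeff_eq ((𝒟.chart_degLE l).2 j)
    refine ⟨⟨k, Nat.lt_succ_of_le hkB⟩, hk1, ?_⟩
    show MonicBox (fun β => coeffVal 𝒟 (.N l j β)) k
    rw [← monicIn0_boxPoly_iff _ hkB, hbox]
    exact hmon
  · have hbox : boxPoly (fun β => coeffVal 𝒟 (.δ i β)) = (𝒟.piece i).δ :=
      boxPoly_coeff_eq (𝒟.piece_degLE i).2.2.2.1
    by_contra hall
    push Not at hall
    exact 𝒟.δ_ne_zero i (by rw [← hbox]; exact (boxPoly_eq_zero_iff _).mpr hall)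
  · rw [pieceOf_coeffVal] at hx
    have h := 𝒟.subset i x hx
    rw [hV] at h
    exact h s
  · have hxV : x ∈ V := by rw [hV]; exact hx
    rcases 𝒟.cover x hxV with ⟨l, hl⟩ | ⟨i, hi⟩
    · exact Or.inl ⟨l, by rw [chartOf_coeffVal]; exact hl⟩
    · exact Or.inr ⟨i, by rw [pieceOf_coeffVal]; exact hi⟩
  · rw [pieceOf_coeffVal] at hi hi'
    obtain ⟨l, hl⟩ := 𝒟.overlap i i' x hii' hi hi'
    exact ⟨l, by rw [chartOf_coeffVal]; exact hl⟩
  · rw [pieceOf_coeffVal]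
    exact 𝒟.param i

/-- **The shape condition yields a decomposition** of complexity `B ⊔ (n + 1) B`. [folklore] -/
theorem decomposition_of_condSem (c : Fin r × Box n e → K) (σ : ShapeIdx n B)
    (w : ShapeVar n B σ.1.1 σ.1.2.1 σ.1.2.2 → K)
    (h : CondSem n B σ.1.1 σ.1.2.1 σ.1.2.2 r e K c w) :
    Nonempty (Decomposition K n {x | ∀ s, eval x (fOf c s) = 0} (B ⊔ (n + 1) * B)) := by
  obtain ⟨h1, h2, h3, h4, h5, h6, h7⟩ := h
  have hd : (σ.1.1 : ℕ) ≤ n := Nat.le_of_lt_succ σ.1.1.isLt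
  have hdeg : ∀ {m' : ℕ} (cm : Box m' B → K), m' ≤ n + 1 →
      (boxPoly cm).totalDegree ≤ B ⊔ (n + 1) * B := fun cm hm =>
    (totalDegree_boxPoly_le_mul cm).trans ((Nat.mul_le_mul_right B hm).trans le_sup_right)
  have hmonic : ∀ i, ∃ k : ℕ, 1 ≤ k ∧ MonicIn0 (pieceOf w i).m k ∧ CertBox (fun β => w (.m i β)) k := by
    intro i
    obtain ⟨k, hk1, hmon, hcert⟩ := h1 i
    exact ⟨k, hk1, (monicIn0_boxPoly_iff _ (Nat.le_of_lt_succ k.isLt)).mpr hmon, hcert⟩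
  refine ⟨{
    d := σ.1.1
    μ := σ.1.2.1
    piece := pieceOf w
    L := σ.1.2.2
    chart := chartOf w
    d_le := hd
    one_le_μ := σ.2.1
    μ_le := (Nat.le_of_lt_succ σ.1.2.1.isLt).trans le_sup_left
    L_le := (Nat.le_of_lt_succ σ.1.2.2.isLt).trans le_sup_left
    L_eq_zero := σ.2.2
    piece_degLE := fun i => ⟨fun k => hdeg _ (by omega), hdeg _ (by omega), hdeg _ (by omega),
      hdeg _ (by omega), fun j => hdeg _ (by omega)⟩
    chart_degLE := fun l => ⟨fun k => hdeg _ (by omega), fun j => hdeg _ (by omega)⟩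
    piece_monic := fun i => ?_
    chart_monic := fun l j => ?_
    isAbsIrreducible := fun i => ?_
    δ_ne_zero := fun i => ?_
    subset := h4
    cover := h5
    overlap := fun i i' x hii' => h6 i i' hii' x
    param := h7 }⟩
  · obtain ⟨k, hk1, hmon, -⟩ := hmonic i
    exact ⟨k, hk1, hmon⟩
  · obtain ⟨k, hk1, hmon⟩ := h2 l j
    exact ⟨k, hk1, (monicIn0_boxPoly_iff _ (Nat.le_of_lt_succ k.isLt)).mpr hmon⟩
  · obtain ⟨k, -, hmon, hcert⟩ := hmonic i
    exact isAbsIrreducible_of_certBox _ hmon hcert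
  · obtain ⟨β, hβ⟩ := h3 i
    intro h0
    exact hβ ((boxPoly_eq_zero_iff _).mp h0 β)

end Bridges

/-! ### Compactness and transfer -/

section Transfer

open FiniteField

/-- **Lang–Weil shape transfer.** For all `e, n, r` there are `B` and `q₀` such that over every
finite field with at least `q₀` elements, the rational zero set of any system of `r` polynomials
of degree `≤ e` in `n` variables is empty or has a rational-trace decomposition of complexity
`≤ B`.  Proof: Theorem A over the pseudo-finite fields (which are perfect), the definability of
the shape condition, compactness (`exists_uniform_bound_of_pseudoFinite`) and transfer
(`eventually_realize_forall_of_pseudoFinite`). [cite: ChatzidakisVanDenDriesMacintyre1992, Prop. 3.3 (proof)] -/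
theorem exists_decomposition_finiteField (e n r : ℕ) :
    ∃ B q₀ : ℕ, ∀ (F : Type) [Field F] [Fintype F], q₀ ≤ Fintype.card F →
      ∀ f : Fin r → MvPolynomial (Fin n) F, (∀ i, (f i).totalDegree ≤ e) →
        {x | ∀ i, eval x (f i) = 0} = ∅ ∨
          Nonempty (Decomposition F n {x | ∀ i, eval x (f i) = 0} B) := by
  classical
  -- one formula per complexity
  have hθ := fun B => exists_formula_semB n B r e
  choose θ hθ using hθ
  -- every tuple of every pseudo-finite field satisfies some `θ_B` (Theorem A)
  have hall : ∀ (K : Type) [Field K] [CompatibleRing K] [Infinite K], K ⊨ finiteFieldTheory →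
      ∀ c : Fin r × Box n e → K, ∃ B, (θ B).Realize c := by
    intro K _ _ _ hK c
    haveI := perfectField_of_model_finiteFieldTheory K hK
    rcases exists_decomposition (K := K) (fOf c) with hempty | ⟨B, ⟨𝒟⟩⟩
    · refine ⟨0, (hθ 0 K c).mpr (Or.inl ?_)⟩
      rintro ⟨x, hx⟩
      have : x ∈ {x | ∀ i, eval x (fOf c i) = 0} := hx
      rw [hempty] at this
      exact this
    · exact ⟨B, (hθ B K c).mpr (semB_of_decomposition c rfl 𝒟)⟩
  obtain ⟨N, hN⟩ := exists_uniform_bound_of_pseudoFinite θ hall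
  -- the disjunction of the `θ_B`, `B ≤ N`, holds in every pseudo-finite field
  obtain ⟨φ, hφ⟩ := definable_iSup (ι := Fin (N + 1))
    (P := fun B K _ _ c => (θ B).Realize c) (fun B => ⟨θ B, fun K _ _ c => Iff.rfl⟩)
  have hφall : ∀ (K : Type) [Field K] [CompatibleRing K] [Infinite K], K ⊨ finiteFieldTheory →
      ∀ c : Fin r × Box n e → K, φ.Realize c := by
    intro K _ _ _ hK c
    obtain ⟨B, hBN, hB⟩ := hN K hK c
    exact (hφ K c).mpr ⟨⟨B, Nat.lt_succ_of_le hBN⟩, hB⟩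
  obtain ⟨q₀, hq₀⟩ := eventually_realize_forall_of_pseudoFinite φ hφall
  refine ⟨N ⊔ (n + 1) * N, q₀, fun F _ _ hF f hf => ?_⟩
  letI := compatibleRingOfRing F
  -- the coefficients of `f`
  let c : Fin r × Box n e → F := fun sβ => (f sβ.1).coeff sβ.2.toExp
  have hfc : ∀ s, fOf c s = f s := fun s => boxPoly_coeff_eq (hf s)
  have hV : {x : Fin n → F | ∀ i, eval x (f i) = 0} = {x | ∀ s, eval x (fOf c s) = 0} := by
    simp only [hfc]
  obtain ⟨⟨B, hBlt⟩, hB⟩ := (hφ F c).mp (hq₀ F hF c)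
  have hBN : B ≤ N := Nat.le_of_lt_succ hBlt
  rcases (hθ B F c).mp hB with hnone | ⟨σ, w, hcond⟩
  · left
    rw [hV]
    ext x
    simp only [Set.mem_setOf_eq, Set.mem_empty_iff_false, iff_false]
    exact fun hx => hnone ⟨x, hx⟩
  · right
    obtain ⟨𝒟⟩ := decomposition_of_condSem c σ w hcond
    rw [hV]
    refine ⟨𝒟.mono ?_⟩
    exact sup_le_sup hBN (Nat.mul_le_mul_left _ hBN)

end Transfer

end Literature.ModelTheory.PseudofiniteFields

end
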